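import Summits.BirchSwinnertonDyer.BirchSwinnertonDyer.Theses.RamifiedSevenEllipticUnits
import Summits.BirchSwinnertonDyer.Rank1Residual.X12.CMSevenAwayFromSeven
import Literature.NumberTheory.EllipticCurves.IsogenySelmerGroups
import Literature.NumberTheory.EllipticCurves.IsogenyMordellWeilRankProofs
import Literature.NumberTheory.EllipticCurves.Regulator
import Literature.NumberTheory.EllipticCurves.Sha
import Mathlib.NumberTheory.NumberField.ClassNumber
import Mathlib.FieldTheory.SplittingField.IsSplittingField
import HarnessLib

set_option linter.dupNamespace false

/-!
# K1₁ TYPED — the level-one shadow of crux idea `cuspidal-descent-kolyvagin-nonvanishing`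
# for `EllipticUnitValueSevenOfGZK` (stmt-BirchSwinnertonDyer-19945); planner bsd-idea-20 g27
# (pays critic price P-γ «D1″ vocabulary, then the K1₁ stub»)

Statements only (`def … : Prop`); nothing below is proved and no summit statement is proved by this
seat. Companion memo: `CuspidalDescentK1One-g27.md` (same crux directory); card REV 4
`Ideas/cuspidal-descent-kolyvagin-nonvanishing.md`.

## Setting (card K1/P4; memo g25 §2)

The type-III members of class `𝒞₇` (`Rank1Residual.X12.ClassCSeven`) with `j = −3375` are the
quadratic twists `E_D ≅ 49a1^{(D)}` (`D < 0`, `2 ∤ D`, every prime `q ∣ D` split in `ℚ(√−7)`; all of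
this is implied by `ClassCSeven W` together with the presentation `IsTypeIII W D` below: `D` squarefree, `7 ∤ D`, `W ≅ 49a1^{(D)}`). Each
carries exactly one rational `7`-isogeny `φ : E_D → E'_D ≅ 49a3^{(D)} = 49a1^{(−7D)}` with kernel
`E_D[φ] ≅ 𝔽₇(ω⁵χ_D)` and dual `φ̂ : E'_D → E_D`, `φ̂ ∘ φ = [7]`. Write `e″ := dim_𝔽₇ E_D(ℚ)/φ̂E'_D(ℚ)`,
`e′ := dim_𝔽₇ E'_D(ℚ)/φE_D(ℚ)`; on a rank-one member `e′ + e″ = 1` (`ExactlyOneKummerSide`).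

**K1₁** (card, K1b at level `n = 1` on members with `I(D,d″) ∈ ℤ₇ˣ`): `r⁻(D) ≥ 1 ⟹ e″ = 0`, i.e.
`E_D(ℚ) ⊂ φ̂(E'_D(ℚ)) + E_D(ℚ)_tors`, where `7^{r⁻(D)} = #Sel^φ(E_D/ℚ)` (Theorem A of memo g25 §2).
Four typed currencies of the same statement, pairwise equivalent modulo the SUPPORT statements at the
end of the file (equivalences: memo g27 §2):

* `KOneOneSelmer`  — hypothesis `Sel^φ(E_D/ℚ) ≠ 0` (INTRINSIC form; the tree's
  `WeierstrassCurve.Isogeny.selmerGroup`, file `Literature/…/IsogenySelmerGroups.lean` — this is the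
  vocabulary D1″ that REV 2/REV 3 of the card recorded as missing: it EXISTS, so D1″ is withdrawn);
* `KOneOneSha`     — hypothesis `Ш(E'_D/ℚ)[7] ≠ 0` (tree `WeierstrassCurve.sha`; `⟺ r⁻ ≥ 1` by A1 + B);
* `KOneOneClassGroup` — hypothesis `rk₇Cl(F_D) ≥ 1 + rk₇Cl(ℚ(√−7D)) + rk₇Cl(ℚ(√D))`,
  `F_D = ℚ(ζ₇+ζ₇⁻¹, √−7D)` (three PLAIN `7`-ranks over Mathlib's `ClassGroup (𝓞 ·)`; by the reflection
  bookkeeping of memo g27 §1 this implies `r⁻ ≥ 1`, and is equivalent to it when `7 ∤ h(ℚ(√D))`) — the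
  PARI currency of falsifier F2b;
* `KOneOneRegulator` — conclusion `Reg(E_D/ℚ) = 7·Reg(E'_D/ℚ)` (tree `WeierstrassCurve.regulator`;
  `⟺ e″ = 0` on rank one by `ĥ(φ̂Q) = 7ĥ(Q)`, tree `Isogeny.canonicalHeight_pointHom_eq`) — the
  `ellrank` currency of F2b (`R(D) = 7` vs the `r⁻ = 0` value `1/7`).

BSD-consistency (memo g27 §4, not used): BSD₇ for `E_D` with `7 ∤ Ш_an(E_D)` predicts K1₁ (the
alternative `e″ = 1` forces `Ш(E_D)[φ] ≅ (ℤ/7)^{r⁻}`), so K1₁ is an intermediate statement strictly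
between "nothing" and BSD₇ on the hard stratum `{r⁻ ≥ 1}` = case (C) of the card; it is falsifiable by
one PARI session (F2b: `D = −79` first).

## References

* card `Ideas/cuspidal-descent-kolyvagin-nonvanishing.md` (REV 4), K1/K1₁/P4; memos
  `CuspidalDescentF1F2-g25.md` §2 (Theorem A, A1, B), `CuspidalDescentK1One-g27.md` §§1–5.
* J. Top, *Descent by 3-isogeny and 3-rank of quadratic fields*, in: Advances in Number Theory
  (Kingston 1991), OUP 1993, 303–317 [corpus:book:gouvea1993-advances-number-theory-proceedings-third-conference-canadian p.241–245] (template of Theorem A).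
* E. F. Schaefer, M. Stoll, *How to do a p-descent on an elliptic curve*, Trans. AMS 356 (2004) 1209–1231 (isogeny descent, local conditions).
* J. H. Silverman, *AEC* 2nd ed., X.4 (Selmer group of an isogeny; Remark X.4.7), VIII.9 (regulator).
* G. Gras, *Class Field Theory*, Springer 2003, II.5.4 (reflection theorem / Spiegelungssatz with characters) and
  H. W. Leopoldt, J. reine angew. Math. 199 (1958) 165–174 (Spiegelungssatz).
* J. E. Cremona, *Algorithms for Modular Elliptic Curves*, Table 1, N = 49 (curves 49a1–a4, isogeny degrees 2, 7).
-/

noncomputable section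

open scoped Classical NumberField Polynomial
open Polynomial WeierstrassCurve

namespace Summit.BirchSwinnertonDyer.BirchSwinnertonDyer.Cruxes.EllipticUnitValueSevenOfGZK.CuspidalDescent.K1

open Summit.BirchSwinnertonDyer.Rank1Residual.X12

/-! ## §0 The two conductor-49 models and the twist presentation -/

/-- Cremona `49a1 = [1, −1, 0, −2, −1]` = `X₀(49)`: `j = −3375`, `Δ = −7³`, CM by `ℤ[(1+√−7)/2]`,
`E(ℚ) ≅ ℤ/2`, one rational `7`-isogeny (to `49a3`). [cite: Cremona1997Algorithms, Table 1, N = 49] -/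
def c49a1 : WeierstrassCurve ℚ := ⟨1, -1, 0, -2, -1⟩

/-- Cremona `49a3 = [1, −1, 0, −107, 552]` ≅ `49a1^{(−7)}`: `j = −3375`, `Δ = −7⁹`; the target of the
rational `7`-isogeny from `49a1`. Recorded for the F2b protocol (`E'_D ≅ 49a3^{(D)}`); the typed
statements below never name it (the `7`-isogenous partner is quantified). [cite: Cremona1997Algorithms, Table 1, N = 49] -/
def c49a3 : WeierstrassCurve ℚ := ⟨1, -1, 0, -107, 552⟩

/-- Sanity: `Δ(49a1) = −343 = −7³` and `Δ(49a3) = −40353607 = −7⁹`. [folklore] -/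
example : c49a1.Δ = -343 ∧ c49a3.Δ = -40353607 := by
  refine ⟨?_, ?_⟩ <;>
  norm_num [c49a1, c49a3, WeierstrassCurve.Δ, WeierstrassCurve.b₂, WeierstrassCurve.b₄,
    WeierstrassCurve.b₆, WeierstrassCurve.b₈]

/-- Sanity: `j(49a1) = c₄³/Δ = −3375`, i.e. `c₄³ = −3375·Δ` (`c₄ = 105`). [folklore] -/
example : c49a1.c₄ ^ 3 = -3375 * c49a1.Δ := by
  norm_num [c49a1, WeierstrassCurve.c₄, WeierstrassCurve.Δ, WeierstrassCurve.b₂, WeierstrassCurve.b₄,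
    WeierstrassCurve.b₆, WeierstrassCurve.b₈]

/-- **`W` is a model of the twist `49a1^{(D)}`**: `W` is `ℚ`-isomorphic (a `VariableChange ℚ`) to the
quadratic twist of `49a1` by `D` (tree `WeierstrassCurve.quadraticTwist`; same binder shape as
`CuspidalDescentManinTransport.lean`). Only the square class of `D` matters; `D = 0` is excluded by
`[W.IsElliptic]` wherever this is used. For `W ∈ 𝒞₇` this says: `W` is a TYPE-III member with
`j = −3375` (`v₇(Δ_min) = 3`), as opposed to the `49a3^{(D)}`-side (`v₇(Δ_min) = 9`) or `j = 16581375`. [folklore] -/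
def IsTwistOf49a1 (W : WeierstrassCurve ℚ) (D : ℤ) : Prop :=
  ∃ v : VariableChange ℚ, v • c49a1.quadraticTwist (D : ℚ) = W

/-- **Type-III presentation**: `W ≅ 49a1^{(D)}` with `D` SQUAREFREE and `7 ∤ D`. The two arithmetic
conditions pick the canonical representative of the square class and — the point — separate the
`49a1^{(D)}`-side (type III, `v₇(Δ_min) = 3`, kernel character of the `7`-isogeny `ω⁵χ_D`) from its
`7`-isogenous partner `49a3^{(D)} ≅ 49a1^{(−7D)}` (type IX, `v₇(Δ_min) = 9`), which is ALSO a `𝒞₇`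
member and on which the roles of `φ`, `φ̂` (and the two Selmer counts of Theorem A) are swapped.
With `ClassCSeven W` this forces: `D < 0` (root number `χ_D(−1) = −1`), `D ≡ 1 (mod 4)` (`2 ∤ N`),
every prime `q ∣ D` split in `ℚ(√−7)`, hence `(D/7) = −1`. [folklore] -/
def IsTypeIII (W : WeierstrassCurve ℚ) (D : ℤ) : Prop :=
  Squarefree D ∧ ¬ (7 : ℤ) ∣ D ∧ IsTwistOf49a1 W D

/-- Certificate: `49a3 ≅ 49a1^{(−7)}` over `ℚ` — the variable change `(u, r, s, t) = (1, −2, 1/2, 0)`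
carries the tree's twist model `49a1.quadraticTwist (−7) = [0, 21/4, 0, −98, 343]` to Cremona's
`49a3 = [1, −1, 0, −107, 552]`; hence `49a3^{(D)} ≅ 49a1^{(−7D)}` (type IX = the `−7D` square class).
[cite: Cremona1997Algorithms, Table 1, N = 49] -/
theorem isTwistOf49a1_c49a3 : IsTwistOf49a1 c49a3 (-7) := by
  refine ⟨⟨1, -2, 1 / 2, 0⟩, ?_⟩
  ext <;> norm_num [WeierstrassCurve.variableChange_a₁, WeierstrassCurve.variableChange_a₂,
    WeierstrassCurve.variableChange_a₃, WeierstrassCurve.variableChange_a₄,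
    WeierstrassCurve.variableChange_a₆, WeierstrassCurve.quadraticTwist, c49a1, c49a3,
    WeierstrassCurve.b₂, WeierstrassCurve.b₄, WeierstrassCurve.b₆]

/-! ## §1 The conclusion of K1₁: `E(ℚ) ⊂ ψ(E'(ℚ)) + E(ℚ)_tors` -/

/-- **`e″(ψ) = 0`**: every rational point of `E = W` is, up to a point of finite order, the image under
the isogeny `ψ : E' → E` of a rational point of `E'` — computed in `E(ℚ̄)` through the tree's inclusion
`toGeomPoints : E(ℚ) ↪ E(ℚ̄)` and the isogeny's action on `ℚ̄`-points. Equivalently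
`E(ℚ) = ψ(E'(ℚ)) + E(ℚ)_tors`, i.e. `dim_𝔽₇ E(ℚ)/ψE'(ℚ) = 0` when `deg ψ = 7` and `E(ℚ)[7] = 0`.
Trivially true when `E(ℚ)` is finite; the statements below use it only on `𝒞₇` (rank one).
[cite: SilvermanAEC2009, X.4 (Remark X.4.7)] -/
def RatPointsInImageUpToTorsion {W W' : WeierstrassCurve ℚ} (ψ : Isogeny W' W) : Prop :=
  ∀ P : W.toAffine.Point, ∃ Q : W'.toAffine.Point,
    IsOfFinAddOrder (W.toGeomPoints P - ψ (W'.toGeomPoints Q))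

/-! ## §2 K1₁, intrinsic (Selmer) form — over the tree's `Isogeny.selmerGroup` (D1″ exists) -/

/-- **K1₁ (Selmer form) — crux-idea statement, conjectural, rank-2 shadow of K1b at level one.**
For a type-III `𝒞₇` member `E = W ≅ 49a1^{(D)}` with its `7`-isogeny `φ : E → E'` and dual
`ψ = φ̂` (`ψ ∘ φ = [7]` on `E(ℚ̄)`): if `Sel^φ(E/ℚ) ≠ 0` then `E(ℚ) ⊂ φ̂(E'(ℚ)) + tors` (`e″ = 0`).
Since `#Sel^φ(E/ℚ) = 7^{r⁻(D)}` (Theorem A), the hypothesis is `r⁻(D) ≥ 1` — the HARD stratum (C) of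
the card, where the level-one derived class `pr_* c(1)` vanishes. Equivalent readings (given
`ExactlyOneKummerSide` and Theorem A): `Sel^φ(E/ℚ) ≠ 0 ⟹ Sel^φ(E/ℚ) ⊄ Ш`, i.e.
`dim Ш(E/ℚ)[φ] = r⁻ − 1` and `dim Ш(E'/ℚ)[φ̂] = r⁻ + 1`. Why it might fail: it is exactly the
prediction of BSD₇ with `7 ∤ Ш_an(E_D)`; a member with `r⁻ ≥ 1` and `Reg(E_D)/Reg(E'_D) = 1/7`
refutes it (falsifier F2b, PARI, `D = −79` first) — and would exhibit `Ш(E_D)[7] ⊇ (ℤ/7)²` or refute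
BSD₇(E_D). Sources: card K1/K1₁; memo g25 §2; Top 1993 (3-isogeny template); Silverman X.4.
[conjecture] -/
def KOneOneSelmer : Prop :=
  ∀ (W : WeierstrassCurve ℚ) [W.IsElliptic] [W.IsGloballyMinimal], ClassCSeven W →
    (∃ D : ℤ, IsTypeIII W D) →
    ∀ (W' : WeierstrassCurve ℚ) [W'.IsElliptic] (φ : Isogeny W W') (ψ : Isogeny W' W),
      φ.degree = 7 → (∀ P, ψ (φ P) = (7 : ℤ) • P) →
      (∃ c ∈ φ.selmerGroup, c ≠ 0) → RatPointsInImageUpToTorsion ψ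

/-! ## §3 K1₁, Ш form — over the tree's `WeierstrassCurve.sha` -/

/-- **K1₁ (Ш form).** For a type-III `𝒞₇` member `E = W ≅ 49a1^{(D)}` and ANY `7`-isogeny
`ψ : E' → E` from an elliptic curve (there is exactly one up to `±1`: `E' ≅ 49a3^{(D)}`, `ψ = φ̂`, since
`E` has a unique rational `7`-subgroup): if `Ш(E'/ℚ)[7] ≠ 0` then `E(ℚ) ⊂ ψ(E'(ℚ)) + tors`.
Equivalent to `KOneOneSelmer`: `r⁻ = 0 ⟹ Ш(E')[7^∞] = 0` (A1) and `r⁻ ≥ 1 ⟹ Ш(E')[φ̂] ≠ 0` (B),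
memo g25 §2, so `Ш(E')[7] ≠ 0 ⟺ r⁻ ≥ 1`. Why it might fail: as `KOneOneSelmer`. [conjecture] -/
def KOneOneSha : Prop :=
  ∀ (W : WeierstrassCurve ℚ) [W.IsElliptic] [W.IsGloballyMinimal], ClassCSeven W →
    (∃ D : ℤ, IsTypeIII W D) →
    ∀ (W' : WeierstrassCurve ℚ) [W'.IsElliptic] (ψ : Isogeny W' W), ψ.degree = 7 →
      (∃ c ∈ W'.sha, c ≠ 0 ∧ (7 : ℕ) • c = 0) → RatPointsInImageUpToTorsion ψ

/-! ## §4 K1₁, class-group form — three plain `7`-ranks (the PARI currency of F2b) -/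

/-- `#Cl(F)[7]`, the number of ideal classes of the number field `F` killed by `7` (Mathlib's
`ClassGroup (𝓞 F)`, finite: `NumberField.RingOfIntegers.instFintypeClassGroup`). A power of `7`.
[folklore] -/
def sevenTorsionCard (F : Type) [Field F] [NumberField F] : ℕ :=
  Nat.card {c : ClassGroup (𝓞 F) // c ^ 7 = 1}

/-- `rk₇ Cl(F) := log₇ #Cl(F)[7]` (exact, `#Cl(F)[7]` being a power of `7`). [folklore] -/
def sevenRank (F : Type) [Field F] [NumberField F] : ℕ :=
  Nat.log 7 (sevenTorsionCard F)

/-- `X³ + X² − 2X − 1`, the minimal polynomial of `ζ₇ + ζ₇⁻¹ = 2cos(2π/7)`; splitting field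
`ℚ(ζ₇)⁺`, the cyclic cubic field of conductor `7` (class number `1`). [folklore] -/
def realCycloSevenPoly : ℚ[X] :=
  X ^ 3 + X ^ 2 - C 2 * X - C 1

/-- **`F` is (a copy of) `F_D := ℚ(ζ₇ + ζ₇⁻¹, √(−7D))`** — the splitting field over `ℚ` of
`(X³ + X² − 2X − 1)(X² + 7D)`: for `D < 0` a totally real cyclic sextic field, the fixed field of
`ker(ωχ_D)` in `ℚ(ζ₇, √D)` (`= L₁⁺`), in whose class group the card's `r⁻(D) = rk Cl^{(ω⁵χ_D)}` lives
(memo g27 §1). [folklore] -/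
def IsFD (D : ℤ) (F : Type) [Field F] [NumberField F] : Prop :=
  Polynomial.IsSplittingField ℚ F (realCycloSevenPoly * (X ^ 2 + C (7 * (D : ℚ))))

/-- **`M` is (a copy of) `ℚ(√d)`** — the splitting field of `X² − d` over `ℚ` (`= ℚ` if `d` is a
square; never the case below). [folklore] -/
def IsQuadSqrt (d : ℤ) (M : Type) [Field M] [NumberField M] : Prop :=
  Polynomial.IsSplittingField ℚ M (X ^ 2 - C (d : ℚ))

/-- **K1₁ (class-group form).** For a type-III `𝒞₇` member `E = W ≅ 49a1^{(D)}`: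
`rk₇Cl(F_D) ≥ 1 + rk₇Cl(ℚ(√−7D)) + rk₇Cl(ℚ(√D)) ⟹ E(ℚ) ⊂ ψ(E'(ℚ)) + tors` for every `7`-isogeny
`ψ : E' → E`. The hypothesis is a sufficient condition for `r⁻(D) ≥ 1` by the reflection bookkeeping
`rk₇Cl(F_D) = rk₇Cl(ℚ(√−7D)) + r(ωχ_D) + r⁻(D)`, `r(ωχ_D) ≤ rk₇Cl(ℚ(√D))` (memo g27 §1; Leopoldt's
Spiegelungssatz in `ℚ(ζ₇, √D)`), and equivalent to it when `7 ∤ h(ℚ(√D))` (all members `|D| ≤ 3000`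
have `h(D) < 7²`, most `7 ∤ h(D)`); so `KOneOneSelmer ∧ TheoremASelmerCounts ⟹ KOneOneClassGroup`.
This is the form a PARI seat checks (F2b: `bnfinit` of the sextic and the two quadratics, `ellrank`
twice). Why it might fail: as `KOneOneSelmer`; additionally VACUITY must be excluded numerically — no
member with `r⁻ ≥ 1` has yet been exhibited (F2b computes the first candidates; `D = −79` has
`7 ∣ β₁`, the Bernoulli shadow). [conjecture] -/
def KOneOneClassGroup : Prop :=
  ∀ (W : WeierstrassCurve ℚ) [W.IsElliptic] [W.IsGloballyMinimal], ClassCSeven W →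
    ∀ D : ℤ, IsTypeIII W D →
    ∀ (F M K : Type) [Field F] [NumberField F] [Field M] [NumberField M] [Field K] [NumberField K],
      IsFD D F → IsQuadSqrt (-7 * D) M → IsQuadSqrt D K →
      1 + sevenRank M + sevenRank K ≤ sevenRank F →
      ∀ (W' : WeierstrassCurve ℚ) [W'.IsElliptic] (ψ : Isogeny W' W), ψ.degree = 7 →
        RatPointsInImageUpToTorsion ψ

/-! ## §5 K1₁, regulator form — `R(D) = Reg(E_D)/Reg(E'_D) = 7` (the `ellrank` currency of F2b) -/

/-- **K1₁ (regulator form).** Same hypotheses as `KOneOneClassGroup`; conclusion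
`Reg(E/ℚ) = 7 · Reg(E'/ℚ)` (tree `WeierstrassCurve.regulator`, model-independent by
`regulator_variableChange`). On a rank-one member `e″ = 0 ⟺ Reg(E) = ĥ_E(φ̂ g') = 7 ĥ_{E'}(g') = 7 Reg(E')`
and `e″ = 1 ⟺ Reg(E) = Reg(E')/7` (`ĥ ∘ φ̂ = 7 ĥ`, tree `Isogeny.canonicalHeight_pointHom_eq`;
`Reg > 0`), so this is `KOneOneClassGroup` in the currency PARI's `ellrank`/Cremona's tables print;
THEOREM side (P4/A1): `r⁻ = 0 ⟹ R(D) = 1/7`. Why it might fail: as `KOneOneSelmer`. [conjecture] -/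
def KOneOneRegulator : Prop :=
  ∀ (W : WeierstrassCurve ℚ) [W.IsElliptic] [W.IsGloballyMinimal], ClassCSeven W →
    ∀ D : ℤ, IsTypeIII W D →
    ∀ (F M K : Type) [Field F] [NumberField F] [Field M] [NumberField M] [Field K] [NumberField K],
      IsFD D F → IsQuadSqrt (-7 * D) M → IsQuadSqrt D K →
      1 + sevenRank M + sevenRank K ≤ sevenRank F →
      ∀ (W' : WeierstrassCurve ℚ) [W'.IsElliptic] (ψ : Isogeny W' W), ψ.degree = 7 →
        W.regulator = 7 * W'.regulator

/-! ## §6 SUPPORT statements (paper-proved or routine; not cruxes) -/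

/-- **Support (e′ + e″ = 1; routine given GZK).** On a type-III `𝒞₇` member (Mordell–Weil rank one by
Gross–Zagier–Kolyvagin — the crux's own antecedent `rank_eq_analyticRank_of_analyticRank_le_one` —
and no rational `7`-torsion on `E`, `E'`: the kernel characters `ω⁵χ_D`, `ω²χ_D` are non-trivial),
EXACTLY ONE of `e′(φ) = 0`, `e″(φ̂) = 0` holds: with `g`, `g'` generators modulo torsion,
`φ(g) ≡ a g'`, `φ̂(g') ≡ b g`, `ab = ±7`. Pure algebra of Silverman X.4.7 (tree pattern:
`Literature/…/IsogenyRangeIndex.lean`, `Isogeny.exists_pointHom`). [cite: SilvermanAEC2009, X.4 (Remark X.4.7)] -/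
def ExactlyOneKummerSide : Prop :=
  Literature.NumberTheory.EllipticCurves.rank_eq_analyticRank_of_analyticRank_le_one →
  ∀ (W : WeierstrassCurve ℚ) [W.IsElliptic] [W.IsGloballyMinimal], ClassCSeven W →
    (∃ D : ℤ, IsTypeIII W D) →
    ∀ (W' : WeierstrassCurve ℚ) [W'.IsElliptic] (φ : Isogeny W W') (ψ : Isogeny W' W),
      φ.degree = 7 → (∀ P, ψ (φ P) = (7 : ℤ) • P) →
      (RatPointsInImageUpToTorsion ψ ↔ ¬ RatPointsInImageUpToTorsion φ)

/-- **Support (Theorem A of memo g25 §2, paper-proved; level-one `φ`-descent count).** For a type-III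
`𝒞₇` member `E ≅ 49a1^{(D)}` with `φ : E → E'`, `ψ = φ̂`: `#Sel^φ(E/ℚ) = 7^{r⁻}` and
`#Sel^ψ(E'/ℚ) = 7^{1 + r⁻}`, `r⁻ = r(ω⁵χ_D)`; in PLAIN-rank currency (memo g27 §1:
`rk₇Cl(F_D) = rk₇Cl(ℚ(√−7D)) + r(ωχ_D) + r⁻`, `r(ωχ_D) = rk₇Cl(ℚ(√D)) − t`, `t ∈ {0,1}`, and
`t = 0` when `7 ∤ h(ℚ(√D))`): there is `t ≤ 1` with
`#Sel^φ(E) · #Cl(ℚ(√−7D))[7] · #Cl(ℚ(√D))[7] = 7^t · #Cl(F_D)[7]` and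
`#Sel^ψ(E') · #Cl(ℚ(√−7D))[7] · #Cl(ℚ(√D))[7] = 7^{t+1} · #Cl(F_D)[7]`. The statement asserts in
particular that both Selmer groups are FINITE (`Nat.card ≠ 0`; AEC X.4.2 (b)). Inputs: Kummer
description `H¹(ℚ, 𝔽₇(θ)) ≅ (L₁ˣ/7)^{(ωθ⁻¹)}`, `L₁ = ℚ(ζ₇, √D)`; local conditions: unramified at
`q ∣ D` and at `q ∤ 7D`, `L₇ = 0` / `L'₇ =` everything at `7` (type III: `E(ℚ₇) ⊗ ℤ₇ ≅ ℤ₇`,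
`(D/7) = −1`), no condition at `∞`; unit characters of `L₁`: `ω; ω², ω⁴, ωχ_D, ω³χ_D, ω⁵χ_D`
(`L₁` is CM with `L₁⁺ = F_D`). Why it might fail (as a transcription): the local condition at `7` for
`Sel^φ` (`L₇ = 0`) is the delicate input — if it were `L₇ = ` "finite part" the first count becomes
`7^{r_odd}` with `r⁻ ≤ r_odd ≤ r⁻ + 1`; the second count is robust. Sources: memo g25 §2; Top 1993;
Schaefer–Stoll 2004 §§3–6; ROUTE-U Lemmas D1–D3. [cite: SilvermanAEC2009, X.4 (Thm. X.4.2)] -/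
def TheoremASelmerCounts : Prop :=
  ∀ (W : WeierstrassCurve ℚ) [W.IsElliptic] [W.IsGloballyMinimal], ClassCSeven W →
    ∀ D : ℤ, IsTypeIII W D →
    ∀ (F M K : Type) [Field F] [NumberField F] [Field M] [NumberField M] [Field K] [NumberField K],
      IsFD D F → IsQuadSqrt (-7 * D) M → IsQuadSqrt D K →
      ∀ (W' : WeierstrassCurve ℚ) [W'.IsElliptic] (φ : Isogeny W W') (ψ : Isogeny W' W),
        φ.degree = 7 → (∀ P, ψ (φ P) = (7 : ℤ) • P) →
        ∃ t ≤ 1,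
          Nat.card φ.selmerGroup * sevenTorsionCard M * sevenTorsionCard K =
              7 ^ t * sevenTorsionCard F ∧
            Nat.card ψ.selmerGroup * sevenTorsionCard M * sevenTorsionCard K =
              7 ^ (t + 1) * sevenTorsionCard F

/-- **Support (A1 + B of memo g25 §2, in Ш-currency; paper-proved from Theorem A and e′ + e″ = 1).**
For a type-III `𝒞₇` member with `φ`, `ψ = φ̂` as above: `Sel^φ(E/ℚ) ≠ 0 ⟺ Ш(E'/ℚ)[7] ≠ 0`
(A1: `r⁻ = 0 ⟹ e″ = 1`, `Ш(E)[7^∞] = Ш(E')[7^∞] = 0`; B: `r⁻ ≥ 1 ⟹ dim Ш(E')[φ̂] = 1 + r⁻ − e″ ≥ r⁻ ≥ 1`).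
This is the glue `KOneOneSelmer ⟺ KOneOneSha`. [cite: SilvermanAEC2009, X.4 (Thm. X.4.2 and Remark X.4.7)] -/
def SelmerNonzeroIffShaSeven : Prop :=
  Literature.NumberTheory.EllipticCurves.rank_eq_analyticRank_of_analyticRank_le_one →
  ∀ (W : WeierstrassCurve ℚ) [W.IsElliptic] [W.IsGloballyMinimal], ClassCSeven W →
    (∃ D : ℤ, IsTypeIII W D) →
    ∀ (W' : WeierstrassCurve ℚ) [W'.IsElliptic] (φ : Isogeny W W') (ψ : Isogeny W' W),
      φ.degree = 7 → (∀ P, ψ (φ P) = (7 : ℤ) • P) →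
      ((∃ c ∈ φ.selmerGroup, c ≠ 0) ↔ ∃ c ∈ W'.sha, c ≠ 0 ∧ (7 : ℕ) • c = 0)

/-! ## §7 Bookkeeping: the four currencies and the crux, by name -/

/-- The crux this vocabulary serves, by name (elaboration check only). -/
example : Prop :=
  Summit.BirchSwinnertonDyer.BirchSwinnertonDyer.Theses.RamifiedSevenEllipticUnits.EllipticUnitValueSevenOfGZK

/-- **How the currencies relate (memo g27 §2), recorded as one typed implication to be proved by a
prover seat, not here:** the intrinsic form together with the two support statements gives the
class-group form. (`KOneOneSelmer → TheoremASelmerCounts → KOneOneClassGroup`: the first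
count reads `r⁻ + rk M + rk K = t + rk F`, so `1 + rk M + rk K ≤ rk F` gives `r⁻ ≥ t + 1 ≥ 1`, i.e.
`Sel^φ ≠ 0`; the dual partner `φ` of the given `ψ` (`ψ ∘ φ = [7]`) comes from
`Isogeny.exists_dual_of_isElliptic` and the surjectivity of isogenies on `ℚ̄`-points.) [folklore] -/
def CurrencyGlue : Prop :=
  KOneOneSelmer → TheoremASelmerCounts → KOneOneClassGroup

end Summit.BirchSwinnertonDyer.BirchSwinnertonDyer.Cruxes.EllipticUnitValueSevenOfGZK.CuspidalDescent.K1

end
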